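import Summits.AtomisticToContinuum.HydrodynamicLimit.Theorems.RelayRaceLocalityNearConstantShortTimeHLFluxIntegrability
import Summits.AtomisticToContinuum.HydrodynamicLimit.Theorems.JaynesSqueezeEntropicWeakStrongHSShellA
import Literature.Analysis.FluidPDE.HardSphereTrajectoryMeasurable
import HarnessLib

/-!
# Crux `NearConstantShortTimeHL` (stmt-AtomisticToContinuum-12502), line `small-tilt-domination` — integrability of the closure fluxes along an orbit

Support file for the crux `…Theses.RelayRaceLocality.NearConstantShortTimeHL`, line `small-tilt-domination`
(lead c3, wave 2): the registered stubs `intervalIntegrable_momFlux_orbit` and `intervalIntegrable_enFlux_orbit` —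
the time integrands of the K-stub defects `momDefect` / `enDefect` along the hard-sphere orbit `r ↦ Φ_r z` of a
good datum `z`,

* `r ↦ Σⱼ m_{Φ_r z}[∂ₜψⱼ(r)]ⱼ + ∫ (Σᵢⱼ (∂ᵢψ(r))ⱼ m̃ᵢm̃ⱼ/ρ̃ + p̃ div ψ(r)) dx` (momentum, vector test `ψ`),
* `r ↦ e_{Φ_r z}[∂ₜφ(r)] + ∫ (ẽ + p̃) Σᵢ (m̃ᵢ/ρ̃) (∇φ(r))ᵢ dx` (energy, scalar test `φ`),

are interval integrable on `[a, b]` when the test function has smooth slices and time derivative / space partials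
continuous on `[a, b] × 𝕋³`. Proof: BOUNDED on `[a, b]` — speeds along the orbit are `≤ √(2E(z))` (energy
conservation `HardSphereFlow.configEnergy_flow`), the coefficients are bounded on the compact strip, and the
pointwise flux bounds `wg_abs_momFlux_le` / `wg_abs_enFlux_le` of `…FluxIntegrability` are uniform in `r` (the
compressibility factor only sees the finitely many ball densities `j/(nV_ℓ)`); MEASURABLE — the orbit is Borel in
time (`IsHardSphereTrajectory.measurable_torus`) with continuous positions, so the flux integrand is a.e.-measurable
on the strip (`wg_aemeasurable_momFlux_of`) and its space integral is a.e.-strongly measurable in `r`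
(`AEStronglyMeasurable.integral_prod_right'`); bounded + measurable on `[a, b]` ⇒ integrable (the unit-volume bound
`|∫ G| ≤ sup |G|` on `𝕋³` is `EntropicWeakStrong.abs_integral_le_of_abs_le`). The packing cap and
the analytic band in the signatures are not used (they matter for the SIZE of the defects, not integrability).

References: H.-T. Yau, Lett. Math. Phys. 22 (1991) §2; I. Gallagher – L. Saint-Raymond – B. Texier, From Newton to
Boltzmann (2013) §4.1 (orbits are piecewise free flight; folklore).
-/

noncomputable section

namespace Summit.AtomisticToContinuum.HydrodynamicLimit.Theorems.NearConstantShortTimeHL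

open scoped BigOperators ENNReal
open MeasureTheory Set Filter
open Literature.MathematicalPhysics.KineticTheory Literature.Analysis.FluidPDE Literature.Analysis.FunctionSpaces

/-! ## Tools -/

/-- A real function which is a.e.-strongly measurable and bounded on `[a, b]` (`a ≤ b`) is interval integrable.
[folklore] -/
theorem wg_intervalIntegrable_of_bound {f : ℝ → ℝ} {a b : ℝ} (hab : a ≤ b) {C : ℝ}
    (hm : AEStronglyMeasurable f (volume.restrict (Icc a b))) (hb : ∀ r ∈ Icc a b, |f r| ≤ C) :
    IntervalIntegrable f volume a b := by
  rw [intervalIntegrable_iff_integrableOn_Icc_of_le hab]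
  refine Integrable.of_bound hm C ?_
  rw [ae_restrict_iff' measurableSet_Icc]
  exact ae_of_all _ fun r hr => (Real.norm_eq_abs _).trans_le (hb r hr)

/-- Speeds along a good orbit are bounded by `√(2E(z))` (energy conservation). [folklore] -/
theorem wg_norm_vel_flow_le {ε : ℝ} {n : ℕ} (Φ : HardSphereFlow (Torus.geometry (Fin 3)) ε n)
    {z : Config n (Fin 3) T3} (hz : z ∈ Φ.good) (r : ℝ) (i : Fin n) :
    ‖(Φ.flow r z i).2‖ ≤ Real.sqrt (2 * configEnergy z) := by
  have h := wg_norm_vel_le (Φ.flow r z) i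
  rwa [Φ.configEnergy_flow hz r] at h

/-- A space integral of a function a.e.-measurable on the strip `[a, b] × 𝕋³` is a.e.-strongly measurable in the
time variable on `[a, b]` (Fubini measurability, `AEStronglyMeasurable.integral_prod_right'`). [folklore] -/
theorem wg_aestronglyMeasurable_integral_strip {G : ℝ → T3 → ℝ} {a b : ℝ}
    (hG : AEMeasurable (Function.uncurry G) (volume.restrict (Icc a b ×ˢ (univ : Set T3)))) :
    AEStronglyMeasurable (fun r => ∫ x, G r x) (volume.restrict (Icc a b)) := by
  have h : AEStronglyMeasurable (Function.uncurry G) ((volume.restrict (Icc a b)).prod (volume : Measure T3)) := by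
    rw [Measure.restrict_prod_eq_prod_univ, ← Measure.volume_eq_prod ℝ T3]
    exact hG.aestronglyMeasurable
  exact h.integral_prod_right'

/-- A function continuous on the strip `[a, b] × 𝕋³`, evaluated along a continuous curve `r ↦ (r, X r)`, is
a.e.-strongly measurable on `[a, b]`. [folklore] -/
theorem wg_aestronglyMeasurable_comp_curve {E : Type*} [TopologicalSpace E] [TopologicalSpace.PseudoMetrizableSpace E]
    {F : ℝ × T3 → E} {a b : ℝ} (hF : ContinuousOn F (Icc a b ×ˢ (univ : Set T3))) {X : ℝ → T3}
    (hX : Continuous X) : AEStronglyMeasurable (fun r => F (r, X r)) (volume.restrict (Icc a b)) := by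
  have h : ContinuousOn (F ∘ fun r => (r, X r)) (Icc a b) :=
    hF.comp (continuous_id.prodMk hX).continuousOn fun r hr => mk_mem_prod hr (mem_univ _)
  exact h.aestronglyMeasurable measurableSet_Icc

/-! ## The momentum flux along an orbit -/

/-- **Registered stub `intervalIntegrable_momFlux_orbit`.** Along the orbit of a good datum, the time integrand of
`momDefect` (raw momentum field tested against `∂ₜψ`, plus the space integral of the Euler momentum flux of the ball
averages against `∇ψ`, `div ψ`) is interval integrable on `[a, b]`: bounded (energy conservation, compact strip,
finitely many ball densities) and measurable (Borel orbit, Fubini). [cite: Yau1991, §2] -/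
theorem intervalIntegrable_momFlux_orbit : ∀ {η₀ : ℝ} {F : ℝ → ℝ}, 0 < η₀ → AnalyticOnNhd ℝ F (Set.Ioo (-η₀) η₀) → Set.EqOn hsExcessFreeEnergy F (Set.Ico 0 η₀) → ∀ {σ : ℝ}, 0 < σ → ∀ {η₁ : ℝ}, 0 < η₁ → η₁ < η₀ → ∀ {ε : ℝ} {n : ℕ} (Φ : HardSphereFlow (Torus.geometry (Fin 3)) ε n) {z : Config n (Fin 3) T3}, z ∈ Φ.good → ∀ {a b : ℝ}, a ≤ b → ∀ {ℓ : ℝ}, 0 < ℓ → ℓ < 1 / 2 → packCapOn Φ z (Set.Icc a b) ℓ σ η₁ → ∀ {S : Set ℝ} {ψ : ℝ → T3 → V3}, (∀ r ∈ Set.Icc a b, Torus.IsSmooth (ψ r)) → ContinuousOn (fun p : ℝ × T3 => Torus.timeDerivWithin S ψ p.1 p.2) (Set.Icc a b ×ˢ Set.univ) → (∀ i, ContinuousOn (fun p : ℝ × T3 => Torus.partialDeriv i (ψ p.1) p.2) (Set.Icc a b ×ˢ Set.univ)) → IntervalIntegrable (fun r => (∑ j, (empiricalMomentumField (Φ.flow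 r z) (fun y => Torus.timeDerivWithin S ψ r y j)) j) + ∫ x, ((∑ i, ∑ j, (Torus.partialDeriv i (ψ r) x) j * (empiricalMomentumField (Φ.flow r z) (ballKernel ℓ x) i * empiricalMomentumField (Φ.flow r z) (ballKernel ℓ x) j / empiricalDensityField (Φ.flow r z) (ballKernel ℓ x))) + hsPressure σ (empiricalDensityField (Φ.flow r z) (ballKernel ℓ x)) (2 / 3 * (empiricalEnergyField (Φ.flow r z) (ballKernel ℓ x) / empiricalDensityField (Φ.flow r z) (ballKernel ℓ x) - ‖empiricalMomentumField (Φ.flow r z) (ballKernel ℓ x)‖ ^ 2 / (2 * empiricalDensityField (Φ.flow r z) (ballKernel ℓ x) ^ 2))) * Torus.divergence (ψ r) x)) volume a b := by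
  intro η₀ F _ _ _ σ _ η₁ _ _ ε n Φ z hz a b hab ℓ _ _ _ S ψ hψ hψt hψx
  -- the orbit: Borel in time, continuous positions, speeds bounded by energy conservation
  have htraj := Φ.isTrajectory z hz
  have hWm : Measurable fun r => Φ.flow r z := htraj.measurable_torus
  have hpos : ∀ i, Continuous fun r => (Φ.flow r z i).1 := htraj.pos_continuous
  have hCv : 0 ≤ Real.sqrt (2 * configEnergy z) := Real.sqrt_nonneg _
  have hv : ∀ r i, ‖(Φ.flow r z i).2‖ ≤ Real.sqrt (2 * configEnergy z) := wg_norm_vel_flow_le Φ hz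
  -- bounds of the coefficients on the compact strip
  have hK : IsCompact (Icc a b ×ˢ (univ : Set T3)) := isCompact_Icc.prod isCompact_univ
  have hSm : MeasurableSet (Icc a b ×ˢ (univ : Set T3)) := measurableSet_Icc.prod MeasurableSet.univ
  obtain ⟨Ct, hCt⟩ := hK.exists_bound_of_continuousOn hψt
  have hCt0 : 0 ≤ Ct := (norm_nonneg _).trans (hCt (a, 0) (mk_mem_prod (left_mem_Icc.2 hab) (mem_univ _)))
  obtain ⟨Cc, hCc⟩ := hK.exists_bound_of_continuousOn (continuousOn_pi.2 hψx)
  have hc' : ∀ r ∈ Icc a b, ∀ x i j, |(Torus.partialDeriv i (ψ r) x) j| ≤ Cc := fun r hr x i j =>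
    (Real.norm_eq_abs _).symm.le.trans (((PiLp.norm_apply_le _ j).trans
      (norm_le_pi_norm (fun i => Torus.partialDeriv i (ψ r) x) i)).trans (hCc (r, x) (mk_mem_prod hr (mem_univ _))))
  have hdiv : ∀ r ∈ Icc a b, ∀ x, Torus.divergence (ψ r) x = ∑ i, (Torus.partialDeriv i (ψ r) x) i :=
    fun r hr x => Torus.divergence_eq_sum_partialDeriv_apply ((hψ r hr).isContDiff (by simp)) x
  have hd' : ∀ r ∈ Icc a b, ∀ x, |Torus.divergence (ψ r) x| ≤ 3 * Cc := fun r hr x => by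
    rw [hdiv r hr x]
    refine (Finset.abs_sum_le_sum_abs _ _).trans ?_
    calc ∑ i, |(Torus.partialDeriv i (ψ r) x) i| ≤ ∑ _i : Fin 3, Cc := Finset.sum_le_sum fun i _ => hc' r hr x i i
      _ = 3 * Cc := by simp only [Finset.sum_const, Finset.card_univ, Fintype.card_fin, nsmul_eq_mul, Nat.cast_ofNat]
  -- (1) the one-body term `Σⱼ m[∂ₜψⱼ]ⱼ = n⁻¹ Σᵢ Σⱼ ∂ₜψⱼ(r, xᵢ(r)) vᵢⱼ(r)`: measurable and bounded on `[a, b]`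
  have hT : ∀ i j, AEMeasurable (fun r => Torus.timeDerivWithin S ψ r (Φ.flow r z i).1 j)
      (volume.restrict (Icc a b)) := fun i j =>
    (wg_measurable_V3_apply measurable_id j).comp_aemeasurable
      (wg_aestronglyMeasurable_comp_curve hψt (hpos i)).aemeasurable
  have hV : ∀ i j, Measurable fun r => (Φ.flow r z i).2 j := fun i j =>
    wg_measurable_V3_apply ((measurable_pi_apply i).comp hWm).snd j
  have hAm : AEStronglyMeasurable
      (fun r => ∑ j, (empiricalMomentumField (Φ.flow r z) (fun y => Torus.timeDerivWithin S ψ r y j)) j)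
      (volume.restrict (Icc a b)) := by
    simp_rw [empiricalMomentumField_apply_eq_sum]
    exact (Finset.aemeasurable_fun_sum _ fun j _ => (Finset.aemeasurable_fun_sum _ fun i _ =>
      (hT i j).mul (hV i j).aemeasurable).const_mul _).aestronglyMeasurable
  have hAbd : ∀ r ∈ Icc a b,
      |∑ j, (empiricalMomentumField (Φ.flow r z) (fun y => Torus.timeDerivWithin S ψ r y j)) j| ≤
        3 * (Ct * Real.sqrt (2 * configEnergy z)) := fun r hr => by
    simp_rw [empiricalMomentumField_apply_eq_sum]
    refine (Finset.abs_sum_le_sum_abs _ _).trans ?_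
    calc ∑ j, |(n : ℝ)⁻¹ * ∑ i, Torus.timeDerivWithin S ψ r (Φ.flow r z i).1 j * (Φ.flow r z i).2 j|
        ≤ ∑ _j : Fin 3, Ct * Real.sqrt (2 * configEnergy z) := Finset.sum_le_sum fun j _ => by
          rw [abs_mul, abs_of_nonneg (inv_nonneg.2 (Nat.cast_nonneg n))]
          refine (mul_le_mul_of_nonneg_left (Finset.abs_sum_le_sum_abs _ _)
            (inv_nonneg.2 (Nat.cast_nonneg n))).trans (wg_avg_le (fun i => ?_) (mul_nonneg hCt0 hCv))
          rw [abs_mul]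
          refine mul_le_mul ?_ ?_ (abs_nonneg _) hCt0
          · exact (Real.norm_eq_abs _).symm.le.trans ((PiLp.norm_apply_le _ j).trans
              (hCt (r, (Φ.flow r z i).1) (mk_mem_prod hr (mem_univ _))))
          · exact (Real.norm_eq_abs _).symm.le.trans ((PiLp.norm_apply_le _ j).trans (hv r i))
      _ = 3 * (Ct * Real.sqrt (2 * configEnergy z)) := by
          simp only [Finset.sum_const, Finset.card_univ, Fintype.card_fin, nsmul_eq_mul, Nat.cast_ofNat]
  refine IntervalIntegrable.add (wg_intervalIntegrable_of_bound hab hAm hAbd) (wg_intervalIntegrable_of_bound hab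
    (C := (18 * Cc + (∑ j ∈ Finset.range (n + 1),
      |hsCompressibility ((n : ℝ)⁻¹ * (j * (4 / 3 * Real.pi * ℓ ^ 3)⁻¹) * σ ^ 3)|) * (3 * Cc)) *
        (|(4 / 3 * Real.pi * ℓ ^ 3)⁻¹| * (Real.sqrt (2 * configEnergy z) ^ 2 / 2))) ?_ ?_)
  -- (2) the flux integral is a.e.-measurable on `[a, b]` (Fubini on the strip)
  · have hC : ∀ i j, AEMeasurable (fun p : ℝ × T3 => (Torus.partialDeriv i (ψ p.1) p.2) j)
        (volume.restrict (Icc a b ×ˢ univ)) := fun i j =>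
      (wg_measurable_V3_apply measurable_id j).comp_aemeasurable ((hψx i).aestronglyMeasurable hSm).aemeasurable
    have hD : AEMeasurable (fun p : ℝ × T3 => Torus.divergence (ψ p.1) p.2) (volume.restrict (Icc a b ×ˢ univ)) := by
      have h : ContinuousOn (fun p : ℝ × T3 => ∑ i, (Torus.partialDeriv i (ψ p.1) p.2) i) (Icc a b ×ˢ univ) :=
        continuousOn_finsetSum _ fun i _ => (EuclideanSpace.proj (𝕜 := ℝ) i).continuous.comp_continuousOn (hψx i)
      exact ((h.congr fun p hp => hdiv p.1 hp.1 p.2).aestronglyMeasurable hSm).aemeasurable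
    refine wg_aestronglyMeasurable_integral_strip ?_
    exact wg_aemeasurable_momFlux_of σ (C := fun i j (p : ℝ × T3) => (Torus.partialDeriv i (ψ p.1) p.2) j)
      (wg_measurable_ballDensity (W := fun p : ℝ × T3 => Φ.flow p.1 z) (hWm.comp measurable_fst) measurable_snd ℓ)
      (wg_measurable_ballMomentum (W := fun p : ℝ × T3 => Φ.flow p.1 z) (hWm.comp measurable_fst) measurable_snd ℓ)
      (wg_measurable_ballEnergy (W := fun p : ℝ × T3 => Φ.flow p.1 z) (hWm.comp measurable_fst) measurable_snd ℓ)
      hC hD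
  -- (3) the flux integral is bounded on `[a, b]`
  · intro r hr
    exact EntropicWeakStrong.abs_integral_le_of_abs_le fun x => wg_abs_momFlux_le σ ℓ x (Φ.flow r z) (hv r)
      (fun i j => (Torus.partialDeriv i (ψ r) x) j) (Torus.divergence (ψ r) x) (hc' r hr x) (hd' r hr x)

/-! ## The energy flux along an orbit -/

/-- **Registered stub `intervalIntegrable_enFlux_orbit`.** Along the orbit of a good datum, the time integrand of
`enDefect` (raw energy field tested against `∂ₜφ`, plus the space integral of the Euler energy flux of the ball
averages against `∇φ`) is interval integrable on `[a, b]`. [cite: Yau1991, §2] -/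
theorem intervalIntegrable_enFlux_orbit : ∀ {η₀ : ℝ} {F : ℝ → ℝ}, 0 < η₀ → AnalyticOnNhd ℝ F (Set.Ioo (-η₀) η₀) → Set.EqOn hsExcessFreeEnergy F (Set.Ico 0 η₀) → ∀ {σ : ℝ}, 0 < σ → ∀ {η₁ : ℝ}, 0 < η₁ → η₁ < η₀ → ∀ {ε : ℝ} {n : ℕ} (Φ : HardSphereFlow (Torus.geometry (Fin 3)) ε n) {z : Config n (Fin 3) T3}, z ∈ Φ.good → ∀ {a b : ℝ}, a ≤ b → ∀ {ℓ : ℝ}, 0 < ℓ → ℓ < 1 / 2 → packCapOn Φ z (Set.Icc a b) ℓ σ η₁ → ∀ {S : Set ℝ} {φ : ℝ → T3 → ℝ}, (∀ r ∈ Set.Icc a b, Torus.IsSmooth (φ r)) → ContinuousOn (fun p : ℝ × T3 => Torus.timeDerivWithin S φ p.1 p.2) (Set.Icc a b ×ˢ Set.univ) → (∀ i, ContinuousOn (fun p : ℝ × T3 => Torus.partialDeriv i (φ p.1) p.2) (Set.Icc a b ×ˢ Set.univ)) → IntervalIntegrable (fun r => empiricalEnergyField (Φ.flow r z) (Torus.timeDerivWithin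 S φ r) + ∫ x, (empiricalEnergyField (Φ.flow r z) (ballKernel ℓ x) + hsPressure σ (empiricalDensityField (Φ.flow r z) (ballKernel ℓ x)) (2 / 3 * (empiricalEnergyField (Φ.flow r z) (ballKernel ℓ x) / empiricalDensityField (Φ.flow r z) (ballKernel ℓ x) - ‖empiricalMomentumField (Φ.flow r z) (ballKernel ℓ x)‖ ^ 2 / (2 * empiricalDensityField (Φ.flow r z) (ballKernel ℓ x) ^ 2)))) * (∑ i, (empiricalMomentumField (Φ.flow r z) (ballKernel ℓ x) i / empiricalDensityField (Φ.flow r z) (ballKernel ℓ x)) * (Torus.gradient (φ r) x) i)) volume a b := by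
  intro η₀ F _ _ _ σ _ η₁ _ _ ε n Φ z hz a b hab ℓ _ _ _ S φ hφ hφt hφx
  -- the orbit
  have htraj := Φ.isTrajectory z hz
  have hWm : Measurable fun r => Φ.flow r z := htraj.measurable_torus
  have hpos : ∀ i, Continuous fun r => (Φ.flow r z i).1 := htraj.pos_continuous
  have hCv : 0 ≤ Real.sqrt (2 * configEnergy z) := Real.sqrt_nonneg _
  have hv : ∀ r i, ‖(Φ.flow r z i).2‖ ≤ Real.sqrt (2 * configEnergy z) := wg_norm_vel_flow_le Φ hz
  -- bounds of the coefficients on the compact strip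
  have hK : IsCompact (Icc a b ×ˢ (univ : Set T3)) := isCompact_Icc.prod isCompact_univ
  have hSm : MeasurableSet (Icc a b ×ˢ (univ : Set T3)) := measurableSet_Icc.prod MeasurableSet.univ
  obtain ⟨Ct, hCt⟩ := hK.exists_bound_of_continuousOn hφt
  have hCt0 : 0 ≤ Ct := (norm_nonneg _).trans (hCt (a, 0) (mk_mem_prod (left_mem_Icc.2 hab) (mem_univ _)))
  obtain ⟨Cg, hCg⟩ := hK.exists_bound_of_continuousOn (continuousOn_pi.2 hφx)
  have hgrad : ∀ r ∈ Icc a b, ∀ x i, (Torus.gradient (φ r) x) i = Torus.partialDeriv i (φ r) x :=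
    fun r hr x i => Torus.gradient_apply ((hφ r hr).isContDiff (by simp)) x i
  have he' : ∀ r ∈ Icc a b, ∀ x i, |(Torus.gradient (φ r) x) i| ≤ Cg := fun r hr x i => by
    rw [hgrad r hr x i]
    exact (Real.norm_eq_abs _).symm.le.trans ((norm_le_pi_norm (fun i => Torus.partialDeriv i (φ r) x) i).trans
      (hCg (r, x) (mk_mem_prod hr (mem_univ _))))
  -- (1) the one-body term `e[∂ₜφ] = n⁻¹ Σᵢ ∂ₜφ(r, xᵢ(r)) ‖vᵢ(r)‖²/2`: measurable and bounded on `[a, b]`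
  have hT : ∀ i, AEMeasurable (fun r => Torus.timeDerivWithin S φ r (Φ.flow r z i).1)
      (volume.restrict (Icc a b)) := fun i =>
    (wg_aestronglyMeasurable_comp_curve hφt (hpos i)).aemeasurable
  have hV : ∀ i, Measurable fun r => ‖(Φ.flow r z i).2‖ ^ 2 / 2 := fun i =>
    (((measurable_pi_apply i).comp hWm).snd.norm.pow_const 2).div_const 2
  have hAm : AEStronglyMeasurable (fun r => empiricalEnergyField (Φ.flow r z) (Torus.timeDerivWithin S φ r))
      (volume.restrict (Icc a b)) := by
    simp_rw [empiricalEnergyField_eq_sum]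
    exact ((Finset.aemeasurable_fun_sum _ fun i _ => (hT i).mul (hV i).aemeasurable).const_mul _).aestronglyMeasurable
  have hAbd : ∀ r ∈ Icc a b, |empiricalEnergyField (Φ.flow r z) (Torus.timeDerivWithin S φ r)| ≤
      Ct * (Real.sqrt (2 * configEnergy z) ^ 2 / 2) := fun r hr => by
    rw [empiricalEnergyField_eq_sum, abs_mul, abs_of_nonneg (inv_nonneg.2 (Nat.cast_nonneg n))]
    refine (mul_le_mul_of_nonneg_left (Finset.abs_sum_le_sum_abs _ _)
      (inv_nonneg.2 (Nat.cast_nonneg n))).trans (wg_avg_le (fun i => ?_) (by positivity))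
    rw [abs_mul, abs_of_nonneg (by positivity : (0 : ℝ) ≤ ‖(Φ.flow r z i).2‖ ^ 2 / 2)]
    have h1 : ‖(Φ.flow r z i).2‖ ^ 2 ≤ Real.sqrt (2 * configEnergy z) ^ 2 :=
      pow_le_pow_left₀ (norm_nonneg _) (hv r i) 2
    exact mul_le_mul ((Real.norm_eq_abs _).symm.le.trans
      (hCt (r, (Φ.flow r z i).1) (mk_mem_prod hr (mem_univ _)))) (by linarith) (by positivity) hCt0
  refine IntervalIntegrable.add (wg_intervalIntegrable_of_bound hab hAm hAbd) (wg_intervalIntegrable_of_bound hab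
    (C := (|(4 / 3 * Real.pi * ℓ ^ 3)⁻¹| * (Real.sqrt (2 * configEnergy z) ^ 2 / 2)) *
      (1 + ∑ j ∈ Finset.range (n + 1),
        |hsCompressibility ((n : ℝ)⁻¹ * (j * (4 / 3 * Real.pi * ℓ ^ 3)⁻¹) * σ ^ 3)|) *
          (3 * (Real.sqrt (2 * configEnergy z) * Cg))) ?_ ?_)
  -- (2) the flux integral is a.e.-measurable on `[a, b]`
  · have hE : ∀ i, AEMeasurable (fun p : ℝ × T3 => (Torus.gradient (φ p.1) p.2) i)
        (volume.restrict (Icc a b ×ˢ univ)) := fun i => by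
      have h : ContinuousOn (fun p : ℝ × T3 => (Torus.gradient (φ p.1) p.2) i) (Icc a b ×ˢ univ) :=
        (hφx i).congr fun p hp => hgrad p.1 hp.1 p.2 i
      exact (h.aestronglyMeasurable hSm).aemeasurable
    refine wg_aestronglyMeasurable_integral_strip ?_
    exact wg_aemeasurable_enFlux_of σ (E := fun i (p : ℝ × T3) => (Torus.gradient (φ p.1) p.2) i)
      (wg_measurable_ballDensity (W := fun p : ℝ × T3 => Φ.flow p.1 z) (hWm.comp measurable_fst) measurable_snd ℓ)
      (wg_measurable_ballMomentum (W := fun p : ℝ × T3 => Φ.flow p.1 z) (hWm.comp measurable_fst) measurable_snd ℓ)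
      (wg_measurable_ballEnergy (W := fun p : ℝ × T3 => Φ.flow p.1 z) (hWm.comp measurable_fst) measurable_snd ℓ)
      hE
  -- (3) the flux integral is bounded on `[a, b]`
  · intro r hr
    exact EntropicWeakStrong.abs_integral_le_of_abs_le fun x => wg_abs_enFlux_le σ ℓ x (Φ.flow r z) hCv (hv r)
      (fun i => (Torus.gradient (φ r) x) i) (he' r hr x)

end Summit.AtomisticToContinuum.HydrodynamicLimit.Theorems.NearConstantShortTimeHL

end
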